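import Summits.QuantumFields.YangMills.Theorems.LuscherReductionTwistedTraceScalingBOStiffAssembly
import Summits.QuantumFields.YangMills.Theorems.LuscherReductionTwistedTraceScalingBOStiffFibrePSD
import Summits.QuantumFields.YangMills.Theorems.LuscherReductionRunningReductionTraceFormulaAveraging
import HarnessLib

/-!
# (B-ST) assembly step 4, first line: the transfer form of a based average is the form of the BASED KERNEL — `⟨P₀f, K_β P₀f⟩ = ∫∫ f(U) G_β(U,V) f(V)`
# (lane A of S-BASE, crux `TwistedTraceScaling` stmt-QuantumFields-20203, C4-CORE, the (B-ST) pen; HANDOFF-g21 ASSEMBLY RECIPE step 4)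

With `P₀f (U) = ∫ f(U^{basedExt h}) dh` (based average) and the based kernel `G_β(U,V) = ∫ K_β(U, V^{basedExt h}) dh`:
★ `basedKernel_symm` — `G_β(U,V) = G_β(V,U)`; ★ `kernelOfBasedAvg_invariant` — `U ↦ ∫ K_β(U,V) P₀f(V) dV` is based invariant;
★★★ `qform_basedAvg_eq_basedKernel_form` — `qform su2Rep β (P₀f) (P₀f) = ∫ U, ∫ V, f U * G_β(U,V) * f V` for bounded measurable `f`.
This is the identity by which the core piece of `…BOStiffAssembly.hST_of_pieces` becomes a kernel form on the SUPPORT of `f` (inside the near-identity tube, where the tube chart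
`integral_configMeasure_orthoTube` and the transport `…BOStiffTransportCore.basedKernel_core_two_sided` apply), although `P₀f` itself is spread over whole based orbits.
HONEST FRAMING: bookkeeping for a stub of a child of the CONDITIONAL route R2b1; (B-ST) OPEN; C4-CORE OPEN; not infinite volume, not a gap, not Clay.
-/

set_option autoImplicit false

noncomputable section

open MeasureTheory

namespace Summit.QuantumFields.YangMills.Theorems.FemtoTransferGap.TwoLattice.ConstTube

open Literature.MathematicalPhysics.QuantumFieldTheory Literature.MathematicalPhysics.QuantumLattice TwoLattice.Avg

variable {L : ℕ} [NeZero L]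

/-! ## §1 Based extensions and the based kernel -/

omit [NeZero L] in
/-- `basedExt 1 = 1`. [folklore] -/
theorem basedExt_one' : basedExt L (1 : NzSite L → SU2) = 1 := by
  funext x; by_cases hx : x = 0
  · subst hx; simp [basedExt]
  · simp [basedExt, hx]

omit [NeZero L] in
/-- `basedExt h⁻¹ = (basedExt h)⁻¹`. [folklore] -/
theorem basedExt_inv (h : NzSite L → SU2) : basedExt L h⁻¹ = (basedExt L h)⁻¹ := by
  have e := basedExt_inv_mul (L := L) h 1
  rwa [mul_one, basedExt_one', mul_one] at e

/-- `K_β(U, V^{g⁻¹}) = K_β(V, U^{g})` (invariance + symmetry). [cite: SeilerLNP1982, §3] -/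
theorem transferKernel_inv_right (β : ℝ) (g : Site 3 L → SU2) (U V : GaugeConfig 3 L SU2) :
    transferKernel su2Rep β U (gaugeTransform g⁻¹ V) = transferKernel su2Rep β V (gaugeTransform g U) := by
  rw [← transferKernel_gaugeTransform su2Rep β g U (gaugeTransform g⁻¹ V), TT.gaugeTransform_gaugeTransform_inv, transferKernel_su2Rep_symm]

/-- ★ **Symmetry of the based kernel**: `∫ K_β(U, V^{h}) dh = ∫ K_β(V, U^{h}) dh` (inversion invariance of the product Haar measure). [folklore] -/
theorem basedKernel_symm (β : ℝ) (U V : GaugeConfig 3 L SU2) :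
    ∫ h, transferKernel su2Rep β U (gaugeTransform (basedExt L h) V) ∂basedMeasure L = ∫ h, transferKernel su2Rep β V (gaugeTransform (basedExt L h) U) ∂basedMeasure L := by
  rw [← integral_inv_eq_self (fun h : NzSite L → SU2 => transferKernel su2Rep β U (gaugeTransform (basedExt L h) V)) (basedMeasure L)]
  refine integral_congr_ae (ae_of_all _ fun h => ?_)
  dsimp only
  rw [basedExt_inv, transferKernel_inv_right]

/-- The based kernel is bounded by the kernel's sup and nonnegative. [folklore] -/
theorem basedKernel_bounds (β : ℝ) : ∃ M : ℝ, ∀ U V : GaugeConfig 3 L SU2,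
    0 ≤ ∫ h, transferKernel su2Rep β U (gaugeTransform (basedExt L h) V) ∂basedMeasure L ∧ ∫ h, transferKernel su2Rep β U (gaugeTransform (basedExt L h) V) ∂basedMeasure L ≤ M := by
  haveI : IsProbabilityMeasure (basedMeasure L) := by infer_instance
  obtain ⟨M, hM⟩ := exists_transferKernel_le su2Rep continuous_su2Rep β (L := L)
  refine ⟨M, fun U V => ⟨integral_nonneg fun h => (transferKernel_pos su2Rep β _ _).le, ?_⟩⟩
  have h := integral_mono_of_nonneg (μ := basedMeasure L) (f := fun h : NzSite L → SU2 => transferKernel su2Rep β U (gaugeTransform (basedExt L h) V)) (g := fun _ => M)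
    (ae_of_all _ fun h => (transferKernel_pos su2Rep β _ _).le) (integrable_const M) (ae_of_all _ fun h => hM _ _)
  simpa [integral_const] using h

/-! ## §2 The kernel applied to a based average is based invariant -/

/-- For bounded measurable `P`, `U ↦ ∫ K_β(U,V) P(V) dV` is measurable and bounded. [folklore] -/
theorem kernelApply_props (β : ℝ) {P : GaugeConfig 3 L SU2 → ℝ} (hP : Measurable P) {CP : ℝ} (hCP : ∀ U, |P U| ≤ CP) :
    Measurable (fun U => ∫ V, transferKernel su2Rep β U V * P V ∂configMeasure SU2 L) ∧
      ∃ CF : ℝ, ∀ U, |∫ V, transferKernel su2Rep β U V * P V ∂configMeasure SU2 L| ≤ CF := by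
  obtain ⟨M, hM⟩ := exists_transferKernel_le su2Rep continuous_su2Rep β (L := L)
  have hK : Measurable fun p : GaugeConfig 3 L SU2 × GaugeConfig 3 L SU2 => transferKernel su2Rep β p.1 p.2 :=
    (continuous_transferKernel su2Rep continuous_su2Rep β).measurable
  have hJ : Measurable fun p : GaugeConfig 3 L SU2 × GaugeConfig 3 L SU2 => transferKernel su2Rep β p.1 p.2 * P p.2 := hK.mul (hP.comp measurable_snd)
  refine ⟨(hJ.stronglyMeasurable.integral_prod_right' (ν := configMeasure SU2 L)).measurable, ⟨M * CP, fun U => ?_⟩⟩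
  have h := norm_integral_le_of_norm_le_const (μ := configMeasure SU2 L) (f := fun V => transferKernel su2Rep β U V * P V) (C := M * CP)
    (Filter.Eventually.of_forall fun V => by
      rw [Real.norm_eq_abs, abs_mul, abs_of_pos (transferKernel_pos su2Rep β _ _)]
      exact mul_le_mul (hM _ _) (hCP _) (abs_nonneg _) ((transferKernel_pos su2Rep β U V).le.trans (hM _ _)))
  rw [Real.norm_eq_abs] at h
  simpa [Measure.real] using h

/-- ★ If `P` is based invariant then so is `U ↦ ∫ K_β(U,V) P(V) dV`. [folklore] -/
theorem kernelApply_invariant (β : ℝ) {P : GaugeConfig 3 L SU2 → ℝ} (hP : Measurable P)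
    (hPinv : ∀ (h : NzSite L → SU2) (U : GaugeConfig 3 L SU2), P (gaugeTransform (basedExt L h) U) = P U) (h : NzSite L → SU2) (U : GaugeConfig 3 L SU2) :
    (∫ V, transferKernel su2Rep β (gaugeTransform (basedExt L h) U) V * P V ∂configMeasure SU2 L) = ∫ V, transferKernel su2Rep β U V * P V ∂configMeasure SU2 L := by
  have hm : Measurable fun V => transferKernel su2Rep β (gaugeTransform (basedExt L h) U) V * P V := (measurable_transferKernel_left β _).mul hP
  rw [← integral_comp_eq_of_measurePreserving (measurePreserving_gaugeTransform_configMeasure (basedExt L h)) hm]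
  refine integral_congr_ae (ae_of_all _ fun V => ?_)
  dsimp only
  rw [transferKernel_gaugeTransform, hPinv]

/-! ## §3 The identity -/

/-- Moving the based transform from the function to the kernel: `∫ K_β(U,V) f(V^{h}) dV = ∫ K_β(V, U^{h}) f(V) dV`. [folklore] -/
theorem integral_kernel_comp_based (β : ℝ) {f : GaugeConfig 3 L SU2 → ℝ} (hf : Measurable f) (h : NzSite L → SU2) (U : GaugeConfig 3 L SU2) :
    ∫ V, transferKernel su2Rep β U V * f (gaugeTransform (basedExt L h) V) ∂configMeasure SU2 L =
      ∫ V, transferKernel su2Rep β V (gaugeTransform (basedExt L h) U) * f V ∂configMeasure SU2 L := by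
  have hm : Measurable fun V => transferKernel su2Rep β U V * f (gaugeTransform (basedExt L h) V) :=
    (measurable_transferKernel_left β _).mul (hf.comp (measurePreserving_gaugeTransform_configMeasure (basedExt L h)).measurable)
  rw [← integral_comp_eq_of_measurePreserving (measurePreserving_gaugeTransform_configMeasure (basedExt L h)⁻¹) hm]
  refine integral_congr_ae (ae_of_all _ fun V => ?_)
  dsimp only
  rw [TT.gaugeTransform_gaugeTransform_inv, transferKernel_inv_right]

/-- ★★★ **The transfer form of a based average is the based-kernel form of the function**: for bounded measurable `f`,
`⟨P₀f, K_β P₀f⟩ = ∫∫ f(U) (∫ K_β(U, V^{h}) dh) f(V) dU dV`. [cite: SeilerLNP1982, §3] -/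
theorem qform_basedAvg_eq_basedKernel_form (β : ℝ) {f : GaugeConfig 3 L SU2 → ℝ} (hf : Measurable f) {Cf : ℝ} (hCf : ∀ U, |f U| ≤ Cf) :
    qform su2Rep β (fun U => ∫ h, f (gaugeTransform (basedExt L h) U) ∂basedMeasure L) (fun U => ∫ h, f (gaugeTransform (basedExt L h) U) ∂basedMeasure L) =
      ∫ U, ∫ V, f U * (∫ h, transferKernel su2Rep β U (gaugeTransform (basedExt L h) V) ∂basedMeasure L) * f V ∂configMeasure SU2 L ∂configMeasure SU2 L := by
  haveI : IsProbabilityMeasure (basedMeasure L) := by infer_instance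
  obtain ⟨M, hM⟩ := exists_transferKernel_le su2Rep continuous_su2Rep β (L := L)
  have hCf0 : 0 ≤ Cf := (abs_nonneg _).trans (hCf 1)
  obtain ⟨hPm, hPb⟩ := basedIntegral_props (L := L) hf hCf
  obtain ⟨hFm, ⟨CF, hFb⟩⟩ := kernelApply_props (L := L) β hPm hPb
  have hPinv : ∀ (h : NzSite L → SU2) (U : GaugeConfig 3 L SU2),
      (∫ h', f (gaugeTransform (basedExt L h') (gaugeTransform (basedExt L h) U)) ∂basedMeasure L) = ∫ h', f (gaugeTransform (basedExt L h') U) ∂basedMeasure L :=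
    fun h U => basedAvg_invariant f h U
  have hFinv := kernelApply_invariant (L := L) β hPm hPinv
  -- (1) `⟨P, K P⟩ = ∫ P · (K P)`
  have h1 : qform su2Rep β (fun U => ∫ h, f (gaugeTransform (basedExt L h) U) ∂basedMeasure L) (fun U => ∫ h, f (gaugeTransform (basedExt L h) U) ∂basedMeasure L) =
      ∫ U, (∫ h, f (gaugeTransform (basedExt L h) U) ∂basedMeasure L) *
        (∫ V, transferKernel su2Rep β U V * (∫ h, f (gaugeTransform (basedExt L h) V) ∂basedMeasure L) ∂configMeasure SU2 L) ∂configMeasure SU2 L := by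
    rw [qform_eq_integral_integral_bdd β hPm hPb]
    refine integral_congr_ae (ae_of_all _ fun U => ?_)
    dsimp only
    rw [← integral_const_mul]
    exact integral_congr_ae (ae_of_all _ fun V => by dsimp only; ring)
  -- (2) `∫ P·(K P) = ∫ f·(K P)` (based invariance of `K P`)
  have h2 := integral_basedAvg_mul_invariant (L := L) hf hCf hFm hFb hFinv
  -- (3) `(K P)(U) = ∫_V G(U,V) f(V)`
  have h3 : ∀ U, (∫ V, transferKernel su2Rep β U V * (∫ h, f (gaugeTransform (basedExt L h) V) ∂basedMeasure L) ∂configMeasure SU2 L) =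
      ∫ V, (∫ h, transferKernel su2Rep β U (gaugeTransform (basedExt L h) V) ∂basedMeasure L) * f V ∂configMeasure SU2 L := by
    intro U
    -- joint integrand `(V,h) ↦ K(U,V) f(V^h)`
    have hJ : Measurable fun p : GaugeConfig 3 L SU2 × (NzSite L → SU2) => transferKernel su2Rep β U p.1 * f (gaugeTransform (basedExt L p.2) p.1) :=
      ((measurable_transferKernel_left β U).comp measurable_fst).mul (measurable_comp_basedAction hf)
    have hJb : ∀ p : GaugeConfig 3 L SU2 × (NzSite L → SU2), |transferKernel su2Rep β U p.1 * f (gaugeTransform (basedExt L p.2) p.1)| ≤ M * Cf := fun p => by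
      rw [abs_mul, abs_of_pos (transferKernel_pos su2Rep β _ _)]
      exact mul_le_mul (hM _ _) (hCf _) (abs_nonneg _) ((transferKernel_pos su2Rep β U p.1).le.trans (hM _ _))
    have hint : Integrable (fun p : GaugeConfig 3 L SU2 × (NzSite L → SU2) => transferKernel su2Rep β U p.1 * f (gaugeTransform (basedExt L p.2) p.1))
        ((configMeasure SU2 L).prod (basedMeasure L)) := integrable_of_measurable_abs_le _ hJ hJb
    -- joint integrand `(V,h) ↦ K(U,V^h) f(V)`
    have hJ' : Measurable fun p : GaugeConfig 3 L SU2 × (NzSite L → SU2) => transferKernel su2Rep β U (gaugeTransform (basedExt L p.2) p.1) * f p.1 := by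
      have hK : Measurable fun p : GaugeConfig 3 L SU2 × (NzSite L → SU2) => transferKernel su2Rep β U (gaugeTransform (basedExt L p.2) p.1) :=
        measurable_comp_basedAction (measurable_transferKernel_left β U)
      exact hK.mul (hf.comp measurable_fst)
    have hJb' : ∀ p : GaugeConfig 3 L SU2 × (NzSite L → SU2), |transferKernel su2Rep β U (gaugeTransform (basedExt L p.2) p.1) * f p.1| ≤ M * Cf := fun p => by
      rw [abs_mul, abs_of_pos (transferKernel_pos su2Rep β _ _)]
      exact mul_le_mul (hM _ _) (hCf _) (abs_nonneg _) ((transferKernel_pos su2Rep β U (gaugeTransform (basedExt L p.2) p.1)).le.trans (hM _ _))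
    have hint' : Integrable (fun p : GaugeConfig 3 L SU2 × (NzSite L → SU2) => transferKernel su2Rep β U (gaugeTransform (basedExt L p.2) p.1) * f p.1)
        ((configMeasure SU2 L).prod (basedMeasure L)) := integrable_of_measurable_abs_le _ hJ' hJb'
    calc (∫ V, transferKernel su2Rep β U V * (∫ h, f (gaugeTransform (basedExt L h) V) ∂basedMeasure L) ∂configMeasure SU2 L)
        = ∫ V, ∫ h, transferKernel su2Rep β U V * f (gaugeTransform (basedExt L h) V) ∂basedMeasure L ∂configMeasure SU2 L := by
          refine integral_congr_ae (ae_of_all _ fun V => ?_); dsimp only; rw [← integral_const_mul]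
      _ = ∫ h, ∫ V, transferKernel su2Rep β U V * f (gaugeTransform (basedExt L h) V) ∂configMeasure SU2 L ∂basedMeasure L := integral_integral_swap hint
      _ = ∫ h, ∫ V, transferKernel su2Rep β V (gaugeTransform (basedExt L h) U) * f V ∂configMeasure SU2 L ∂basedMeasure L := by
          refine integral_congr_ae (ae_of_all _ fun h => ?_); dsimp only; exact integral_kernel_comp_based β hf h U
      _ = ∫ h, ∫ V, transferKernel su2Rep β U (gaugeTransform (basedExt L h)⁻¹ V) * f V ∂configMeasure SU2 L ∂basedMeasure L := by
          refine integral_congr_ae (ae_of_all _ fun h => integral_congr_ae (ae_of_all _ fun V => ?_)); dsimp only; rw [transferKernel_inv_right]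
      _ = ∫ h, ∫ V, transferKernel su2Rep β U (gaugeTransform (basedExt L h) V) * f V ∂configMeasure SU2 L ∂basedMeasure L := by
          rw [← integral_inv_eq_self (fun h : NzSite L → SU2 => ∫ V, transferKernel su2Rep β U (gaugeTransform (basedExt L h) V) * f V ∂configMeasure SU2 L) (basedMeasure L)]
          refine integral_congr_ae (ae_of_all _ fun h => ?_); dsimp only; rw [basedExt_inv]
      _ = ∫ V, ∫ h, transferKernel su2Rep β U (gaugeTransform (basedExt L h) V) * f V ∂basedMeasure L ∂configMeasure SU2 L := (integral_integral_swap hint').symm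
      _ = ∫ V, (∫ h, transferKernel su2Rep β U (gaugeTransform (basedExt L h) V) ∂basedMeasure L) * f V ∂configMeasure SU2 L := by
          refine integral_congr_ae (ae_of_all _ fun V => ?_); dsimp only; rw [← integral_mul_const]
  rw [h1, h2]
  refine integral_congr_ae (ae_of_all _ fun U => ?_)
  dsimp only
  rw [h3 U, ← integral_const_mul]
  exact integral_congr_ae (ae_of_all _ fun V => by dsimp only; ring)

end Summit.QuantumFields.YangMills.Theorems.FemtoTransferGap.TwoLattice.ConstTube

end
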